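import Summits.BirchSwinnertonDyer.BirchSwinnertonDyer.Theses.ThetaPartnerAtTwo
import Summits.BirchSwinnertonDyer.BirchSwinnertonDyer.Theses.ResidualThetaTransportAtTwo
import Summits.BirchSwinnertonDyer.BirchSwinnertonDyer.Theorems.ThetaPartnerAtTwoSignedMainConjectureCMTwoRankZeroFlatOfCuspSpan
import Summits.BirchSwinnertonDyer.BirchSwinnertonDyer.Theorems.ResidualThetaTransportAtTwoThetaLayerLambdaCongruenceAtTwoCuspSpanOddLevel
import Summits.BirchSwinnertonDyer.BirchSwinnertonDyer.Theorems.ResidualThetaTransportAtTwoCuspSpanDefs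
import HarnessLib

/-!
# Route `ThetaPartnerAtTwo` (TP2), crux μ♭ `AnalyticMuFlatCMTwoRankZero` (stmt-BirchSwinnertonDyer-26470):
# the crux BY NAME from the curve-free node (G′) `CuspSpanEvenAtTwoOdd` (stmt-BirchSwinnertonDyer-27436),
# and the UNCONDITIONAL sub-class `3 ∤ N_A`

Cell `pub/bsd-wall`, width seat `bsd-tp2-w7` g0 (director-bsd keying brief (195); THEOREMS ONLY — no `def`, no `sorry`; helper
`--supports stmt-BirchSwinnertonDyer-26470`; BSD is not proved by any of this).

WHAT IS HERE. The crux μ♭ (item 26470) reads: for every CM curve `A/ℚ` of analytic rank `0`, good supersingular at `2` with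
`a₂(A) = 0`, off the unit zone, every newform `f` of `A` and every Pollack pair `(L⁺, L⁻)` of `f` at `2`, Kobayashi's
`L♭ = kobayashiL 1 L⁺ L⁻` has a unit coefficient. The tree already holds (tp2-p2 g5, `…FlatOfCuspSpan`)
`Theorems.analyticMuFlatNonUnitCMTwo_of_cuspSpan_all : (∀ odd N, (G′)_N) → ⟨26470's body verbatim⟩`, where (G′)_N is the curve-free
dual cusp-span statement `SignedMuAtTwo.CuspSpanEvenAtTwo N` of the RTT seats, and (rtt-p3-w4 g2, `…CuspSpanOddLevel`, p642344)
`SignedMuAtTwo.cuspSpanEvenAtTwo_odd_of_not_three_dvd : Odd N → ¬ 3 ∣ N → CuspSpanEvenAtTwo N`. This file only COMPOSES them: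

* §1 `analyticMuFlatCMTwoRankZero_of_cuspSpanEvenAtTwoOdd` — item 26470 BY NAME ⟸ item 27436 BY NAME (the TP2 route's copy
  `ThetaPartnerAtTwo.CuspSpanEvenAtTwoOdd`; `…_rtt` for the RTT route's copy; both copies have the same text);
* §2 the same from the NAMED predicate `∀ N, ¬ 2 ∣ N → CuspSpanEvenAtTwo N`, resp. `∀ N, Odd N → CuspSpanEvenAtTwo N`;
* §3 `analyticMuFlatCMTwoRankZero_of_forall_three_dvd` — REDUCTION: 26470 ⟸ (G′)_N at the odd levels DIVISIBLE BY `3` only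
  (the `j = 0` / discriminant `−27` CM tail and the twists by `3`), the levels prime to `3` being discharged by the landed theorem;
* §4 `analyticMuFlatCMTwo_at_of_not_three_dvd` / `analyticMuFlatCMTwoRankZero_offThree` — UNCONDITIONAL: 26470's conclusion at
  every `A` (resp. 26470's text with the one extra binder `3 ∤ N_A`) whose conductor is prime to `3` — e.g. the CM families of
  discriminant `−11, −19, −43, −67, −163` (conductors `121·D², 361·D², 1849·D², 4489·D², 26569·D²`) twisted prime to `3`.

So 26470 closes the moment node 27436 (`∀ odd N, CuspSpanEvenAtTwo N`; rtt-p3-w2 g5's all-odd-level row induction) is in the tree,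
by `analyticMuFlatCMTwoRankZero_of_cuspSpanEvenAtTwoOdd CuspSpanEvenAtTwoOdd_proof`. HONEST FRAMING: this is Perrin-Riou's
`μ⁻ = 0` at `p = 2` for these newforms IN THE TREE'S CURRENCY ((G′)_N, `IsPollackPair`, `periodFunctional`); the K2 column's
port-of-print crux K2R0P♭ (26471) and its Kato zeta-element input are untouched; BSD is not proved by any of this.

References: R. Pollack, *On the p-adic L-function of a modular form at a supersingular prime*, Duke Math. J. 118 (2003), Conj. 6.3,
Prop. 6.18 [Pollack2003]; S. Kobayashi, *Iwasawa theory for elliptic curves at supersingular primes*, Invent. Math. 152 (2003),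
Thm. 1.2, (3.6) [Kobayashi2003]; B. Perrin-Riou, *Arithmétique des courbes elliptiques à réduction supersingulière en p*,
Experiment. Math. 12 (2003) [PerrinRiou2003].
-/

set_option autoImplicit false
-- the Theorems namespace of this sub repeats the summit name by design (D-0017 nested layout)
set_option linter.dupNamespace false

noncomputable section

open scoped Classical MatrixGroups ModularForm

open CongruenceSubgroup WeierstrassCurve Literature.NumberTheory.EllipticCurves
  Literature.NumberTheory.EllipticCurves.ModularForms Literature.NumberTheory.EllipticCurves.Rank1Residual
  Summit.BirchSwinnertonDyer.Rank1Residual.Supersingular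
  Summit.BirchSwinnertonDyer.BirchSwinnertonDyer.Theses

namespace Summit.BirchSwinnertonDyer.BirchSwinnertonDyer.Theorems.AnalyticMuFlatAtTwo

/-! ## §1. Item 26470 BY NAME from item 27436 BY NAME -/

/-- **μ♭ ⟸ (G′) at every odd level, BY NAME.** The TP2 crux `AnalyticMuFlatCMTwoRankZero` (stmt-BirchSwinnertonDyer-26470)
follows from the TP2 route's copy of the curve-free node `CuspSpanEvenAtTwoOdd` (stmt-BirchSwinnertonDyer-27436): composition of
`Theorems.analyticMuFlatNonUnitCMTwo_of_cuspSpan_all` (RTT `SignedMuAtTwo.flatAtTwo_of_cuspSpan` + `2 ∤ L ⟹ unit coefficient`) with the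
definitional unfolding of both items. The CM / rank / zone binders of 26470 are carried, not used. BSD is not proved by this.
[cite: Pollack2003, Conj. 6.3 and Prop. 6.18] [cite: Kobayashi2003, Thm. 1.2] -/
theorem analyticMuFlatCMTwoRankZero_of_cuspSpanEvenAtTwoOdd (hG : ThetaPartnerAtTwo.CuspSpanEvenAtTwoOdd) :
    ThetaPartnerAtTwo.AnalyticMuFlatCMTwoRankZero :=
  analyticMuFlatNonUnitCMTwo_of_cuspSpan_all hG

/-- **μ♭ ⟸ (G′) at every odd level, BY NAME — the RTT route's copy of node 27436** (`ResidualThetaTransportAtTwo.CuspSpanEvenAtTwoOdd`,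
same text as the TP2 copy). BSD is not proved by this. [cite: Pollack2003, Conj. 6.3 and Prop. 6.18] -/
theorem analyticMuFlatCMTwoRankZero_of_cuspSpanEvenAtTwoOdd_rtt (hG : ResidualThetaTransportAtTwo.CuspSpanEvenAtTwoOdd) :
    ThetaPartnerAtTwo.AnalyticMuFlatCMTwoRankZero :=
  analyticMuFlatNonUnitCMTwo_of_cuspSpan_all hG

/-- The two route copies of node 27436 are the same statement (definitional). [folklore] -/
theorem cuspSpanEvenAtTwoOdd_tp2_iff_rtt :
    ThetaPartnerAtTwo.CuspSpanEvenAtTwoOdd ↔ ResidualThetaTransportAtTwo.CuspSpanEvenAtTwoOdd :=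
  Iff.rfl

/-- Node 27436 (TP2 copy) is `∀ N, ¬ 2 ∣ N → SignedMuAtTwo.CuspSpanEvenAtTwo N` (definitional; the named predicate of
`…ResidualThetaTransportAtTwoCuspSpanDefs`). [folklore] -/
theorem cuspSpanEvenAtTwoOdd_iff_forall_cuspSpanEvenAtTwo :
    ThetaPartnerAtTwo.CuspSpanEvenAtTwoOdd ↔ ∀ (N : ℕ) [NeZero N], ¬ 2 ∣ N → SignedMuAtTwo.CuspSpanEvenAtTwo N :=
  Iff.rfl

/-! ## §2. Item 26470 from the named predicate `CuspSpanEvenAtTwo` at every odd level -/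

/-- **μ♭ ⟸ `CuspSpanEvenAtTwo N` for every `N` with `2 ∤ N`** (the hypothesis shape of RTT's
`SignedMuAtTwo.flatMuZeroAtTwo_of_forall_cuspSpanEvenAtTwo`). BSD is not proved by this. [cite: Pollack2003, Conj. 6.3 and Prop. 6.18] -/
theorem analyticMuFlatCMTwoRankZero_of_forall_cuspSpanEvenAtTwo
    (hG : ∀ (N : ℕ) [NeZero N], ¬ 2 ∣ N → SignedMuAtTwo.CuspSpanEvenAtTwo N) :
    ThetaPartnerAtTwo.AnalyticMuFlatCMTwoRankZero :=
  analyticMuFlatNonUnitCMTwo_of_cuspSpan_all fun N _ hN ↦ hG N hN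

/-- `¬ 2 ∣ N ⟹ Odd N` (bridge between the two hypothesis shapes in use on the bus). [folklore] -/
theorem odd_of_not_two_dvd {N : ℕ} (hN : ¬ 2 ∣ N) : Odd N :=
  (Nat.even_or_odd N).resolve_left fun h ↦ hN (even_iff_two_dvd.mp h)

/-- **μ♭ ⟸ `CuspSpanEvenAtTwo N` for every odd `N`** (the `Odd N` hypothesis shape of the RTT row-induction files
`…CuspSpanOddLevel` / `…CuspSpanRowInduction*`). BSD is not proved by this. [cite: Pollack2003, Conj. 6.3 and Prop. 6.18] -/
theorem analyticMuFlatCMTwoRankZero_of_forall_odd_cuspSpanEvenAtTwo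
    (hG : ∀ (N : ℕ) [NeZero N], Odd N → SignedMuAtTwo.CuspSpanEvenAtTwo N) :
    ThetaPartnerAtTwo.AnalyticMuFlatCMTwoRankZero :=
  analyticMuFlatCMTwoRankZero_of_forall_cuspSpanEvenAtTwo fun N _ hN ↦ hG N (odd_of_not_two_dvd hN)

/-! ## §3. Reduction of item 26470 to the odd levels divisible by `3` -/

/-- **`CuspSpanEvenAtTwo` at every odd level ⟸ `CuspSpanEvenAtTwo` at the odd levels divisible by `3`**: the levels prime to `3`
are the landed theorem `SignedMuAtTwo.cuspSpanEvenAtTwo_odd_of_not_three_dvd` (rtt-p3-w4 g2). [cite: Pollack2003, Conj. 6.3] -/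
theorem forall_odd_cuspSpanEvenAtTwo_of_forall_three_dvd
    (hG3 : ∀ (N : ℕ) [NeZero N], Odd N → 3 ∣ N → SignedMuAtTwo.CuspSpanEvenAtTwo N) :
    ∀ (N : ℕ) [NeZero N], Odd N → SignedMuAtTwo.CuspSpanEvenAtTwo N := by
  intro N _ hN
  by_cases h3 : 3 ∣ N
  · exact hG3 N hN h3
  · exact SignedMuAtTwo.cuspSpanEvenAtTwo_odd_of_not_three_dvd hN h3

/-- **Node 27436 ⟸ `CuspSpanEvenAtTwo` at the odd levels divisible by `3`** (TP2 copy, by name). [cite: Pollack2003, Conj. 6.3] -/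
theorem cuspSpanEvenAtTwoOdd_of_forall_three_dvd
    (hG3 : ∀ (N : ℕ) [NeZero N], Odd N → 3 ∣ N → SignedMuAtTwo.CuspSpanEvenAtTwo N) :
    ThetaPartnerAtTwo.CuspSpanEvenAtTwoOdd :=
  fun N _ hN ↦ forall_odd_cuspSpanEvenAtTwo_of_forall_three_dvd hG3 N (odd_of_not_two_dvd hN)

/-- **REDUCTION: μ♭ (item 26470) ⟸ `CuspSpanEvenAtTwo N` at the odd levels `N` divisible by `3` only.** The CM classes of
conductor prime to `3` (discriminants `−11, −19, −43, −67, −163` twisted prime to `3`) need nothing further; what is left is the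
`j = 0` / discriminant `−27` tail and the twists by `3`. BSD is not proved by this. [cite: Pollack2003, Conj. 6.3 and Prop. 6.18] -/
theorem analyticMuFlatCMTwoRankZero_of_forall_three_dvd
    (hG3 : ∀ (N : ℕ) [NeZero N], Odd N → 3 ∣ N → SignedMuAtTwo.CuspSpanEvenAtTwo N) :
    ThetaPartnerAtTwo.AnalyticMuFlatCMTwoRankZero :=
  analyticMuFlatCMTwoRankZero_of_forall_odd_cuspSpanEvenAtTwo (forall_odd_cuspSpanEvenAtTwo_of_forall_three_dvd hG3)

/-! ## §4. UNCONDITIONAL: the conclusion of item 26470 at every conductor prime to `3` -/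

/-- The conductor of a curve with good (supersingular) reduction at `2` is odd. [folklore] -/
theorem odd_conductorNorm_of_goodSS {A : WeierstrassCurve ℚ} [A.IsElliptic] [A.IsGloballyMinimal] (hss : GoodSS A 2) :
    Odd (A.conductorNorm ℤ) :=
  odd_of_not_two_dvd (SignedMuAtTwo.not_two_dvd_conductorNorm_of_goodSS hss)

/-- **μ♭ AT `(A, f)` from the NAMED per-level predicate `CuspSpanEvenAtTwo N_A`** (by-name form of tp2-p2 g5's
`Theorems.analyticMuFlatCMTwo_at_of_cuspSpan`; any `A` good supersingular at `2` with `a₂ = 0`, no CM / rank / zone hypothesis).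
BSD is not proved by this. [cite: Pollack2003, Conj. 6.3 and Prop. 6.18] [cite: Kobayashi2003, (3.6)] -/
theorem analyticMuFlatCMTwo_at_of_cuspSpanEvenAtTwo (A : WeierstrassCurve ℚ) [A.IsElliptic] [A.IsGloballyMinimal]
    (hss : GoodSS A 2) (ha : A.frobeniusTrace 2 = 0) [NeZero (A.conductorNorm ℤ)]
    (hG : SignedMuAtTwo.CuspSpanEvenAtTwo (A.conductorNorm ℤ))
    (f : CuspForm (Gamma0 (A.conductorNorm ℤ)) 2) (hf : IsNewformOf A f)
    (Lplus Lminus : IwasawaAlgebra 2) (hPP : IsPollackPair f 2 Lplus Lminus) :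
    ∃ n : ℕ, IsUnit (PowerSeries.coeff n (kobayashiL 1 Lplus Lminus)) :=
  analyticMuFlatCMTwo_at_of_cuspSpan A hss ha hG f hf Lplus Lminus hPP

/-- **UNCONDITIONAL μ♭ AT EVERY `(A, f)` WITH `3 ∤ N_A`.** For `A/ℚ` globally minimal, good supersingular at `2` with `a₂(A) = 0`
and conductor prime to `3`, every newform `f` of `A` and every Pollack pair `(L⁺, L⁻)` of `f` at `2`: `kobayashiL 1 L⁺ L⁻ = L♭` has
a unit coefficient — the node (G′)_{N_A} is the landed theorem `SignedMuAtTwo.cuspSpanEvenAtTwo_odd_of_not_three_dvd` (`N_A` is odd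
by good reduction at `2`). No CM / rank / zone hypothesis. BSD is not proved by this.
[cite: Pollack2003, Conj. 6.3 and Prop. 6.18] [cite: Kobayashi2003, Thm. 1.2] -/
theorem analyticMuFlatCMTwo_at_of_not_three_dvd (A : WeierstrassCurve ℚ) [A.IsElliptic] [A.IsGloballyMinimal]
    (hss : GoodSS A 2) (ha : A.frobeniusTrace 2 = 0) [NeZero (A.conductorNorm ℤ)] (h3 : ¬ 3 ∣ A.conductorNorm ℤ)
    (f : CuspForm (Gamma0 (A.conductorNorm ℤ)) 2) (hf : IsNewformOf A f)
    (Lplus Lminus : IwasawaAlgebra 2) (hPP : IsPollackPair f 2 Lplus Lminus) :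
    ∃ n : ℕ, IsUnit (PowerSeries.coeff n (kobayashiL 1 Lplus Lminus)) :=
  analyticMuFlatCMTwo_at_of_cuspSpanEvenAtTwo A hss ha
    (SignedMuAtTwo.cuspSpanEvenAtTwo_odd_of_not_three_dvd (odd_conductorNorm_of_goodSS hss) h3) f hf Lplus Lminus hPP

/-- **UNCONDITIONAL: item 26470's text with ONE extra binder `3 ∤ N_A`** (inserted after `[NeZero (A.conductorNorm ℤ)]`; the CM /
rank / zone binders are carried, not used). Covers the CM rank-`0` classes of conductor `121·D², 361·D², 1849·D², 4489·D², 26569·D²`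
with `3 ∤ D`; the complement inside 26470 is exactly the reduction §3. BSD is not proved by this.
[cite: Pollack2003, Conj. 6.3 and Prop. 6.18] [cite: Kobayashi2003, Thm. 1.2] -/
theorem analyticMuFlatCMTwoRankZero_offThree :
    ∀ (A : WeierstrassCurve ℚ) [A.IsElliptic] [A.IsGloballyMinimal], A.HasCM → A.analyticRank = 0 → GoodSS A 2 →
      A.frobeniusTrace 2 = 0 → 2 ∣ A.shaOrder * A.tamagawaProduct → ∀ [NeZero (A.conductorNorm ℤ)], ¬ 3 ∣ A.conductorNorm ℤ →
      ∀ (f : CuspForm (Gamma0 (A.conductorNorm ℤ)) 2), IsNewformOf A f → ∀ (Lplus Lminus : IwasawaAlgebra 2),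
      IsPollackPair f 2 Lplus Lminus → ∃ n : ℕ, IsUnit (PowerSeries.coeff n (kobayashiL 1 Lplus Lminus)) :=
  fun A _ _ _ _ hss ha _ _ h3 f hf Lplus Lminus hPP ↦ analyticMuFlatCMTwo_at_of_not_three_dvd A hss ha h3 f hf Lplus Lminus hPP

end Summit.BirchSwinnertonDyer.BirchSwinnertonDyer.Theorems.AnalyticMuFlatAtTwo

end
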